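import Summits.CriticalPhenomena.PercolationContinuityZ3.Theorems.Transplant.SkelPhiParaRunChain
import Summits.CriticalPhenomena.PercolationContinuityZ3.Theorems.Transplant.SkelStepIVInputs
import HarnessLib

/-!
# N1 (the `{±1}` node), LEVEL 1: THE ROUTE SETS OF A STRIDE — the kit-free third of the N1 route datum.  Given a seed centre `c` whose run-frame
# position lies in the `R′`-enlarged core `k` of the run schedule, the link-region radius inside the window ball, a zone box at `c` inside `cyl c Mz`
# (`Mz < n`), windows `Dr ⊇ W(region k)`, `T ⊇ W(core (k+1))`, a subbox weighting `Wt` of the window graph on `Dr`, and the Step-I″ certificate AT `c`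
# for the steered piece, there are route sets `Qt = pgramPrismFin c n h (3ℓ) Rl`, `Ft =` the steered piece with `Ft ⊆ T`, `Qt ⊆ Dr`, `Ft` off the zone
# box and `P_{Wt}(SEED ↔ Ft inside Qt) > 1 − δ₂` — clause (iii) of D″'s `Skelφ.routeDatumS`, for the x- and the y′-family

builds on p205010 (kernel theorem, internal audit signed; external expert review pending) — nothing in this file uses p205010; nothing here is a
claim about the open node `SamePDropOfSkeletonNeg`.
Lane `prim-bschramm`, seat `prim-bschramm-p1` (gen 11; NEG-SCOPE v1.1 §5 / P5-R2; the kit part and the frame transport of the certificate to `c` are the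
kit adapter's (hp-8 lineage, NEG-SCOPE §10(b))); helper file (`--supports stmt-CriticalPhenomena-4575 --as helper`).
* `pgramPrism_subset_graphBall` (`⊆ B_G(t, R)`), `pgramPrism_subset_graphBall_of_mem` (depth: `c ∈ B_G(w₀, R − r)`, `Rl ≤ r ≤ R` ⇒ `⊆ B_G(w₀, R)`);
* **`routeSetsN_x`** (x-run: `Ft = pgSideHalfW c n h ℓ Rl σ (σ·steer)`), **`routeSetsN_y`** (y′-run: `Ft = pgTopPieceW c n h ℓ Rl σ steer v`, clearance `(Mz+4)(n+|h|) ≤ n(ℓ+1)`).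
[cite: KozmaNitzan2024, §4 Lemma 10 Step IV (pp. 20–21), Lemma 11 (pp. 22–23)] [cite: MartineauTassion2017, §4.3 Lemma 4.2]
-/

noncomputable section

open MeasureTheory ProbabilityTheory

namespace Summit.CriticalPhenomena.PercolationContinuityZ3.Theorems.Transplant

namespace Skelφ

open Literature.Probability.Percolation Literature.Probability.LatticeModels SimpleGraph KNLevels
open Literature.Barriers.CriticalPhenomena (graphBall graphBall_mono)
open Skel (winGraph winGraph_le)
open ChainPlanar ChainPara

variable {V : Type} {G : SimpleGraph V} {φ : V → Site 2}

/-- The fat parallelogram lies in the graph ball of its radius about its centre. [folklore] -/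
theorem pgramPrism_subset_graphBall (t : V) (n : ℕ) (h : ℤ) (ℓ R : ℕ) : pgramPrism G φ t n h ℓ R ⊆ graphBall G t R := fun _ hw =>
  (cylBall_subset_prism G φ t _ R (pgramPrism_subset_cylBall G φ t n h ℓ R hw)).1

/-- **Depth**: a fat parallelogram of radius `Rl ≤ r` about a centre `c ∈ B_G(w₀, R − r)` (`r ≤ R`) lies in the window ball `B_G(w₀, R)`.
[cite: KozmaNitzan2024, §4 Lemma 10 Step IV (p. 20)] -/
theorem pgramPrism_subset_graphBall_of_mem {w₀ c : V} {R r Rl : ℕ} (hcw : c ∈ graphBall G w₀ (R - r)) (hr : Rl ≤ r) (hrR : r ≤ R) (n : ℕ) (h : ℤ)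
    (ℓ : ℕ) : pgramPrism G φ c n h ℓ Rl ⊆ graphBall G w₀ R := fun w hw => by
  have h1 : w ∈ graphBall G c r := graphBall_mono G c hr (pgramPrism_subset_graphBall c n h ℓ Rl hw)
  have h2 := BoxProdZ2.mem_graphBall_add G hcw h1
  rwa [Nat.sub_add_cancel hrR] at h2

/-- **THE ROUTE SETS OF AN x-STRIDE** (clause (iii) of the N1 route datum): `Qt := pgramPrismFin c n h (3ℓ) Rl`, `Ft :=` the side half of sign
`σ·τₖ` (`τₖ = steer k (runX c 1)`); `Ft ⊆ T`, `Qt ⊆ Dr`, `Ft` off the zone box, and the certificate at `c` transferred to the subbox weighting.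
[cite: KozmaNitzan2024, §4 Lemma 10 Step IV (pp. 20–21), Lemma 11 (pp. 22–23)] [cite: MartineauTassion2017, §4.3 Lemma 4.2] -/
theorem routeSetsN_x [DecidableEq V] [Countable V] [G.LocallyFinite] {n : ℕ} (hn : 1 ≤ n) (c₀ : V) (h : ℤ) {σ : ℤ} (hσ : σ = 1 ∨ σ = -1) (ℓ : ℕ)
    (R' qB N : ℕ) {w₀ c : V} {R r Rl k Mz : ℕ}
    (hc : runX φ c₀ n h σ c ∈ Finset.Icc ((xRunSched n ℓ h R' qB N).lo k - (((xRunSched n ℓ h R' qB N).R' : ℕ) : Site 2))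
      ((xRunSched n ℓ h R' qB N).hi k + (((xRunSched n ℓ h R' qB N).R' : ℕ) : Site 2)))
    (hcw : c ∈ graphBall G w₀ (R - r)) (hr : Rl ≤ r) (hrR : r ≤ R) {Z : Finset V} (hZ : (↑Z : Set V) ⊆ cyl φ c Mz) (hMz : Mz < n)
    {Dr T : Finset V} (hPD : Win G (runX φ c₀ n h σ) w₀ ((xRunSched n ℓ h R' qB N).region k) R ⊆ Dr)
    (hPT : Win G (runX φ c₀ n h σ) w₀ ((xRunSched n ℓ h R' qB N).core (k + 1)) R ⊆ T)
    {q : unitInterval} {Wt : Sym2 V → unitInterval} (hWD : IsSubbox (winGraph G w₀ R) Wt q Dr) {SEED : Finset V} {δ₂ : ℝ}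
    (hev : 1 - δ₂ < (bondPercolation G q).real (linkIn (pgramPrism G φ c n h (3 * ℓ) Rl) SEED
      (pgSideHalfW G φ c n h ℓ Rl σ (σ * (xPrmW n ℓ h R' qB N).steer k (runX φ c₀ n h σ c 1))))) :
    ∃ Qt Ft : Finset V, Ft ⊆ T ∧ Qt ⊆ Dr ∧ Disjoint Ft Z ∧ 1 - δ₂ < (prodBernoulli Wt).real (linkIn (↑Qt : Set V) SEED Ft) := by
  set τ₀ := (xPrmW n ℓ h R' qB N).steer k (runX φ c₀ n h σ c 1) with hτ₀
  have hQB : ∀ w ∈ pgramPrism G φ c n h (3 * ℓ) Rl, w ∈ graphBall G w₀ R := fun w hw =>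
    pgramPrism_subset_graphBall_of_mem hcw hr hrR n h (3 * ℓ) hw
  have hQD : pgramPrismFin G φ c n h (3 * ℓ) Rl ⊆ Dr := fun w hw => by
    have hw' := (mem_pgramPrismFin G φ).1 hw
    exact hPD ((mem_Win G _).2 ⟨hQB w hw', runX_mem_region_of_link hn c₀ h hσ R' qB N hc hw'⟩)
  refine ⟨pgramPrismFin G φ c n h (3 * ℓ) Rl, pgSideHalfW G φ c n h ℓ Rl σ (σ * τ₀), fun w hw => ?_, hQD, ?_, ?_⟩
  · -- `Ft ⊆ T`
    have hw' : w ∈ pgramPrism G φ c n h (3 * ℓ) Rl := coe_pgSideHalfW_subset (G := G) (φ := φ) c n h ℓ Rl σ _ (Finset.mem_coe.2 hw)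
    exact hPT ((mem_Win G _).2 ⟨hQB w hw', runX_mem_core_succ_of_piece hn c₀ h hσ R' qB N hc hw⟩)
  · -- `Ft` off the zone box
    have hd := disjoint_pgSideHalfW_cyl (G := G) (φ := φ) c hMz h ℓ Rl hσ (σ * τ₀)
    exact Finset.disjoint_left.2 fun w hw hz => Set.disjoint_left.1 hd (Finset.mem_coe.2 hw) (hZ (Finset.mem_coe.2 hz))
  · -- the certificate transferred to the subbox weighting of the window graph
    have hcoe : (↑(pgramPrismFin G φ c n h (3 * ℓ) Rl) : Set V) = pgramPrism G φ c n h (3 * ℓ) Rl := by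
      ext w; simp
    have heq := Skel.real_eq_of_isSubbox_of_le (winGraph_le G w₀ R) hWD hQD
      (Skel.adj_winGraph_of_subset_graphBall fun v hv => hQB v ((mem_pgramPrismFin G φ).1 hv))
      (determinedBy_linkIn (↑(pgramPrismFin G φ c n h (3 * ℓ) Rl)) SEED (pgSideHalfW G φ c n h ℓ Rl σ (σ * τ₀)) subset_rfl)
      (measurableSet_linkIn _ _ _)
    rw [heq, hcoe]
    exact hev

/-- **THE ROUTE SETS OF A y′-STRIDE**: `Qt := pgramPrismFin c n h (3ℓ) Rl`, `Ft :=` the top piece `pgTopPieceW … σ τₖ v` (`τₖ = steer k (runY c 1)`),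
under the zone clearance `(Mz + 4)(n + |h|) ≤ n(ℓ + 1)`. [cite: KozmaNitzan2024, §4 Lemma 10 Step IV (pp. 20–21)] [cite: MartineauTassion2017, §4.3 Lemma 4.2] -/
theorem routeSetsN_y [DecidableEq V] [Countable V] [G.LocallyFinite] {n ℓ : ℕ} {h v : ℤ} (hn : 1 ≤ n) (hv : |v| ≤ n)
    (hlay : (n + h.natAbs : ℕ) ≤ (n : ℤ) * ℓ + 1) (c₀ : V) {σ : ℤ} (hσ : σ = 1 ∨ σ = -1) (R' qB N : ℕ) {w₀ c : V} {R r Rl k Mz : ℕ}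
    (hc : runY φ c₀ n h σ c ∈ Finset.Icc ((yRunSched hn hv hlay R' qB N).lo k - (((yRunSched hn hv hlay R' qB N).R' : ℕ) : Site 2))
      ((yRunSched hn hv hlay R' qB N).hi k + (((yRunSched hn hv hlay R' qB N).R' : ℕ) : Site 2)))
    (hcw : c ∈ graphBall G w₀ (R - r)) (hr : Rl ≤ r) (hrR : r ≤ R) {Z : Finset V} (hZ : (↑Z : Set V) ⊆ cyl φ c Mz)
    (hclear : (Mz + 4) * (n + h.natAbs) ≤ n * (ℓ + 1))
    {Dr T : Finset V} (hPD : Win G (runY φ c₀ n h σ) w₀ ((yRunSched hn hv hlay R' qB N).region k) R ⊆ Dr)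
    (hPT : Win G (runY φ c₀ n h σ) w₀ ((yRunSched hn hv hlay R' qB N).core (k + 1)) R ⊆ T)
    {q : unitInterval} {Wt : Sym2 V → unitInterval} (hWD : IsSubbox (winGraph G w₀ R) Wt q Dr) {SEED : Finset V} {δ₂ : ℝ}
    (hev : 1 - δ₂ < (bondPercolation G q).real (linkIn (pgramPrism G φ c n h (3 * ℓ) Rl) SEED
      (pgTopPieceW G φ c n h ℓ Rl σ ((yPrmW n ℓ h v R' qB N).steer k (runY φ c₀ n h σ c 1)) v))) :
    ∃ Qt Ft : Finset V, Ft ⊆ T ∧ Qt ⊆ Dr ∧ Disjoint Ft Z ∧ 1 - δ₂ < (prodBernoulli Wt).real (linkIn (↑Qt : Set V) SEED Ft) := by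
  set τ₀ := (yPrmW n ℓ h v R' qB N).steer k (runY φ c₀ n h σ c 1) with hτ₀
  have hQB : ∀ w ∈ pgramPrism G φ c n h (3 * ℓ) Rl, w ∈ graphBall G w₀ R := fun w hw =>
    pgramPrism_subset_graphBall_of_mem hcw hr hrR n h (3 * ℓ) hw
  have hQD : pgramPrismFin G φ c n h (3 * ℓ) Rl ⊆ Dr := fun w hw => by
    have hw' := (mem_pgramPrismFin G φ).1 hw
    exact hPD ((mem_Win G _).2 ⟨hQB w hw', runY_mem_region_of_link hn hv hlay c₀ hσ R' qB N hc hw'⟩)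
  refine ⟨pgramPrismFin G φ c n h (3 * ℓ) Rl, pgTopPieceW G φ c n h ℓ Rl σ τ₀ v, fun w hw => ?_, hQD, ?_, ?_⟩
  · have hw' : w ∈ pgramPrism G φ c n h (3 * ℓ) Rl := coe_pgTopPieceW_subset (G := G) (φ := φ) c n h ℓ Rl σ τ₀ v (Finset.mem_coe.2 hw)
    exact hPT ((mem_Win G _).2 ⟨hQB w hw', runY_mem_core_succ_of_piece hn hv hlay c₀ hσ R' qB N hc hw⟩)
  · have hd := disjoint_pgTopPieceW_cyl (G := G) (φ := φ) c hn hclear Rl hσ τ₀ v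
    exact Finset.disjoint_left.2 fun w hw hz => Set.disjoint_left.1 hd (Finset.mem_coe.2 hw) (hZ (Finset.mem_coe.2 hz))
  · have hcoe : (↑(pgramPrismFin G φ c n h (3 * ℓ) Rl) : Set V) = pgramPrism G φ c n h (3 * ℓ) Rl := by
      ext w; simp
    have heq := Skel.real_eq_of_isSubbox_of_le (winGraph_le G w₀ R) hWD hQD
      (Skel.adj_winGraph_of_subset_graphBall fun v hv => hQB v ((mem_pgramPrismFin G φ).1 hv))
      (determinedBy_linkIn (↑(pgramPrismFin G φ c n h (3 * ℓ) Rl)) SEED (pgTopPieceW G φ c n h ℓ Rl σ τ₀ v) subset_rfl)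
      (measurableSet_linkIn _ _ _)
    rw [heq, hcoe]
    exact hev

end Skelφ

end Summit.CriticalPhenomena.PercolationContinuityZ3.Theorems.Transplant

end
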